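import Mathlib

/-!
# Stub `stub_massSq` of line `Sketch` — crux `stmt-MatrixMultiplication-7359` (`SingleAutomatonRigidity`)

Route `MatrixMultiplication/AutomaticSTPPDesigns`, crux `stmt-MatrixMultiplication-7359`
(`Summit.MatrixMultiplication.MatrixMultiplication.Theses.AutomaticSTPPDesigns.SingleAutomatonRigidity`),
line `Sketch`, stub `stub_massSq`.

This is the "few zero-sums" mass bound: with `aᵢ = |Aᵢ|`, `bᵢ = |Bᵢ|`, `cᵢ = |Cᵢ|` and the three
packing bounds `∑ aᵢbᵢ ≤ N`, `∑ bᵢcᵢ ≤ N`, `∑ cᵢaᵢ ≤ N` (`N = |H|`), one has `(∑ aᵢbᵢcᵢ)² ≤ N³`.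
Pure `ℕ` algebra: Cauchy–Schwarz with `rᵢ = aᵢbᵢcᵢ`, `fᵢ = (aᵢbᵢ)(cᵢaᵢ)`, `gᵢ = bᵢcᵢ`, then
`∑ fᵢ ≤ (∑ aᵢbᵢ) N ≤ N²` (since `cᵢaᵢ ≤ ∑ cⱼaⱼ ≤ N` termwise) and `∑ gᵢ ≤ N`.
-/

set_option linter.dupNamespace false

namespace Summit.MatrixMultiplication.MatrixMultiplication.Theorems.SingleAutomatonRigidity

open Finset

/-- **Mass bound from the three packing bounds.** If `∑ aᵢbᵢ ≤ N`, `∑ bᵢcᵢ ≤ N` and `∑ cᵢaᵢ ≤ N`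
for natural-number sequences `a b c` on a finite index type, then `(∑ aᵢbᵢcᵢ)² ≤ N³`
(Cauchy–Schwarz: `(∑ aᵢbᵢcᵢ)² ≤ (∑ (aᵢbᵢ)(cᵢaᵢ)) (∑ bᵢcᵢ) ≤ (N ⬝ N) ⬝ N`). -/
theorem stub_massSq {ι : Type*} [Fintype ι] (a b c : ι → ℕ) (N : ℕ)
    (hab : ∑ i, a i * b i ≤ N) (hbc : ∑ i, b i * c i ≤ N) (hca : ∑ i, c i * a i ≤ N) :
    (∑ i, a i * b i * c i) ^ 2 ≤ N ^ 3 := by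
  -- termwise bound `cᵢ aᵢ ≤ ∑ⱼ cⱼ aⱼ ≤ N`
  have hi : ∀ i, c i * a i ≤ N := fun i =>
    (Finset.single_le_sum (f := fun j => c j * a j) (fun j _ => Nat.zero_le _)
      (Finset.mem_univ i)).trans hca
  -- Cauchy–Schwarz with `rᵢ = aᵢbᵢcᵢ`, `fᵢ = (aᵢbᵢ)(cᵢaᵢ)`, `gᵢ = bᵢcᵢ`
  have hCS : (∑ i, a i * b i * c i) ^ 2 ≤ (∑ i, (a i * b i) * (c i * a i)) * ∑ i, b i * c i :=
    Finset.sum_sq_le_sum_mul_sum_of_sq_le_mul Finset.univ (fun i _ => Nat.zero_le _)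
      (fun i _ => Nat.zero_le _) (fun i _ => le_of_eq (by ring))
  -- `∑ fᵢ ≤ N²`
  have hf : ∑ i, (a i * b i) * (c i * a i) ≤ N ^ 2 :=
    calc ∑ i, (a i * b i) * (c i * a i) ≤ ∑ i, (a i * b i) * N := by
          gcongr with i
          exact hi i
      _ = (∑ i, a i * b i) * N := (Finset.sum_mul _ _ _).symm
      _ ≤ N * N := by gcongr
      _ = N ^ 2 := (sq N).symm
  calc (∑ i, a i * b i * c i) ^ 2 ≤ (∑ i, (a i * b i) * (c i * a i)) * ∑ i, b i * c i := hCS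
    _ ≤ N ^ 2 * N := by gcongr
    _ = N ^ 3 := by ring

end Summit.MatrixMultiplication.MatrixMultiplication.Theorems.SingleAutomatonRigidity
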